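import Mathlib
import Summits.ResolutionOfSingularities.ResolutionOfSingularities.Theorems.RadicialJungCleanModelsLens5TFrameComposition
import HarnessLib

/-!
# Route `RadicialJung`, crux `CleanModels` (stmt-15917): T⁗ port part 10/13 — §I THEOREM T⁗′: `p`-monomial frames, `cleanLU3DefectPRankTwoPMon_of_cossartPiltant2019` (source :2839–3000; the two defs are in the currency)

PORT (line lead `res-B-lead-1` g8, for Sketch rev 32) of res-B-lens-5's crux workfiles `Cruxes/DescentPerfectToAll/Lens5_TFrame.lean` rev 4
(crux ae884a356928; author res-B-lens-5 g15; `lean check` rc 0 · 0 sorries · 0 warnings; crit-1 TRIAGE-146/150 PASS) and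
`Cruxes/DescentPerfectToAll/Lens5_PDegreeCount.lean` rev 3 (crux 100289d6413b; TRIAGE-151 PASS): THEOREMS T⁗ / T⁗′ / T⁗″ / T⁗‴ — the slice
{`[Γ:pΓ] = p²`, `k` of FINITE `p`-rank `r`, `[κ_v : κ_v^p] = p^r`} of the research stub `stub_cleanLU3DefectNonDiscrete` (valuations of MINIMAL
Frobenius defect `d(K|K^p, v) = p`, ANY such ground field: no perfectness, no separability of `K/k` or `κ_v/k`), modulo F-02 `CossartPiltant2019` and
F-32 (`hEmb`) only.  The port is split into def-free modules `…Lens5TFrame{RG,IR,Graded,Port2,Port4Core,Layer,Layer2,Port4,Composition,PMon,PDegreeA,PDegreeB,PDegreeC}`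
over ONE currency module `…Lens5TFrameCurrency` (the authors' `def`s, verbatim); declarations VERBATIM, namespace
`Summit.ResolutionOfSingularities.ResolutionOfSingularities.Theorems.RadicialJungCleanModels.Lens5TFrame` (the authors' §A copy of
`Lens5_PDegreeSep` and the constant-frame corollaries `cleanLU3DefectPRankTwoSepFin_of_frame` / `…SepFin_of_cossartPiltant2019'` are not ported).
OURS · counted 0 · nothing here proves resolution in characteristic `p`.


-/

set_option linter.dupNamespace false -- mandated namespace of this single-conjunct summit

section

open IsLocalRing
open Literature.AlgebraicGeometry.Resolution
open Summit.ResolutionOfSingularities.ResolutionOfSingularities.Theorems.RadicialJung.CleanModels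
open Summit.ResolutionOfSingularities.ResolutionOfSingularities.Theorems.RadicialJung.CleanModels.Lens5
open Summit.ResolutionOfSingularities.ResolutionOfSingularities.Theorems.RadicialJung.CleanModels.Lens5.PRankTwoCurrency
open Summit.ResolutionOfSingularities.ResolutionOfSingularities.Theorems.RadicialJung.CleanModels.Lens5.PRankTwoAssembly
open Summit.ResolutionOfSingularities.ResolutionOfSingularities.Theorems.RadicialJungCleanModels.Lens5RegularityCriterion
open Summit.ResolutionOfSingularities.ResolutionOfSingularities.Theorems.RadicialJungCleanModels.Lens5ChartSurjection

namespace Summit.ResolutionOfSingularities.ResolutionOfSingularities.Theorems.RadicialJungCleanModels.Lens5TFrame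

/-! ## §I (rev 3) `p`-MONOMIAL FRAMES — (MULT), (1), (DEG) discharged: the slice over «`r` elements of `O_v` with `p`-independent residues and
`[K : K^p] = p^{r+3}`»

A frame need not be given axiomatically.  For `w : Fin r → O_v` let `W_e := ∏ i, w_i^{e_i}` (`e : Fin r → Fin p`) be its `p^r` `p`-MONOMIALS.
(MULT) and (1) hold identically (`w_i^p ∈ K^p`, exponents add mod `p`), so a monomial frame is subject to two conditions only: (RPI) for the
monomial family — literally «the residues `w̄_i` are `p`-independent in `κ_v` over `κ_v^p`» — and (DEG), which by the tower `K^p ⊆ K^p(W) ⊆ K` and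
`[K^p(W) : K^p] = p^r` (§D, from RG over `K^p`, where IR is trivial) is the numerical invariant `[K : K^p] = p^{r+3}` of `K` ALONE
(`cleanLU3DefectPRankTwoPMon_of_frame`).  Since `[K : K^p] = p^3·[k : k^p]` for `K/k` finitely generated of transcendence degree `3` (the degree of
imperfection is additive: invariant under finite extensions — count `[L : K^p]` two ways — and `+1` per transcendental element — `k(y) = ⊕ k^p(y) e_i`
for a `k^p`-basis `e_i` of `k`; Becker–MacLane 1940, Bourbaki A.V §13 ex.; BY HAND, memo CLASSBC §25), the kernel slice `CleanLU3DefectPRankTwoPMonAt p`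
reads, for `k` of finite `p`-rank `r₀ = log_p [k : k^p]`: (P2) and «`O_v` contains `r₀` elements whose residues are `p`-independent over `κ_v^p`»,
i.e. `[κ_v : κ_v^p] ≥ [k : k^p]` — which for `κ_v/k` algebraic (automatic under (P2) + `htd`, ✓ currency §K) is `[κ_v : κ_v^p] = [k : k^p] < ∞`.
Case `r = 0` (`W = {1}`, `[K : K^p] = p³`) is THEOREM T's perfect-ground slice with the perfectness of `k` replaced by the one number `[K : K^p]`. -/

section PMonomialFrames


/-- `p`-monomials of elements of `O` lie in `O`. [folklore] -/
theorem pMonomial_mem (p : ℕ) {K : Type} [Field K] {r : ℕ} (O : ValuationSubring K) (w : Fin r → K) (hw : ∀ i, w i ∈ O)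
    (e : Fin r → Fin p) : pMonomial p w e ∈ O := by
  unfold pMonomial
  exact prod_mem fun i _ => pow_mem (hw i) _

/-- Exponents add modulo `p`; the carries are a `p`-th power. [folklore] -/
theorem pMonomial_mul_eq (p : ℕ) [NeZero p] {K : Type} [Field K] {r : ℕ} (w : Fin r → K) (e e' : Fin r → Fin p) :
    pMonomial p w e * pMonomial p w e' = (∏ i, w i ^ (((e i : ℕ) + e' i) / p)) ^ p * pMonomial p w (e + e') := by
  unfold pMonomial
  rw [← Finset.prod_pow, ← Finset.prod_mul_distrib, ← Finset.prod_mul_distrib]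
  refine Finset.prod_congr rfl fun i _ => ?_
  rw [← pow_mul, ← pow_add, ← pow_add, Pi.add_apply, Fin.val_add]
  congr 1
  exact (Nat.div_add_mod' _ _).symm

/-- (MULT) for monomial frames. [folklore] -/
theorem pMonomial_mult (p : ℕ) [NeZero p] {K : Type} [Field K] {r : ℕ} (w : Fin r → K) (e e' : Fin r → Fin p) :
    ∃ d : (Fin r → Fin p) → K, pMonomial p w e * pMonomial p w e' = ∑ u, d u ^ p * pMonomial p w u := by
  classical
  refine ⟨Pi.single (e + e') (∏ i, w i ^ (((e i : ℕ) + e' i) / p)), ?_⟩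
  rw [Finset.sum_eq_single (e + e'), Pi.single_eq_same, pMonomial_mul_eq]
  · intro u _ hu; rw [Pi.single_eq_of_ne hu, zero_pow (NeZero.ne p), zero_mul]
  · intro h; exact absurd (Finset.mem_univ _) h

/-- (1) for monomial frames: `W_0 = 1`. [folklore] -/
theorem pMonomial_one (p : ℕ) [NeZero p] {K : Type} [Field K] {r : ℕ} (w : Fin r → K) :
    ∃ d : (Fin r → Fin p) → K, ∑ u, d u ^ p * pMonomial p w u = 1 := by
  classical
  refine ⟨Pi.single 0 1, ?_⟩
  rw [Finset.sum_eq_single (0 : Fin r → Fin p), Pi.single_eq_same, one_pow, one_mul]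
  · unfold pMonomial
    exact Finset.prod_eq_one fun i _ => by simp
  · intro u _ hu; rw [Pi.single_eq_of_ne hu, zero_pow (NeZero.ne p), zero_mul]
  · intro h; exact absurd (Finset.mem_univ _) h


/-- **T⁗′ ⊂ T⁗** (kernel): a lifted residually `p`-independent family `w` with `[K : K^p] = p^{r+3}` yields the `p`-monomial frame
`W = pMonomial p w` on `S = (Fin r → Fin p)`: (W ⊆ O) trivially, (RPI) = hypothesis, (MULT)/(1) identically, (DEG) by the tower
`[K : K^p] = [K : K^p(W)]·[K^p(W) : K^p] = [K : K^p(W)]·p^r` (§D `finrank_adjoin_frame_eq_card`, RG over `K^p` from §C with trivial IR). [folklore] -/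
theorem cleanLU3DefectPRankTwoPMon_of_frame (p : ℕ) [Fact p.Prime] (hFrame : CleanLU3DefectPRankTwoFrameAt p) :
    CleanLU3DefectPRankTwoPMonAt p := by
  intro k _ _ K _ _ O A hAO hAfg hFrac hdimA hreg hdim3 hzd g₀ hg₀ hdefect htd hnd hP2 Sb _ b hb r w hwO hPI hK
  classical
  have hp : p.Prime := Fact.out
  haveI : NeZero p := ⟨hp.ne_zero⟩
  haveI : CharP K p := charP_of_injective_algebraMap (algebraMap k K).injective p
  set W : (Fin r → Fin p) → K := pMonomial p w with hWdef
  -- `K^p` = the subfield generated by the `p`-th powers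
  set Kp : Subfield K := (frobenius K p).fieldRange with hKpdef
  have hcl : Subfield.closure (Set.range (fun x : K => x ^ p)) = Kp := by
    apply le_antisymm
    · refine Subfield.closure_le.mpr ?_
      rintro z ⟨u, rfl⟩
      exact RingHom.mem_fieldRange.mpr ⟨u, frobenius_def ..⟩
    · intro z hz
      obtain ⟨u, rfl⟩ := RingHom.mem_fieldRange.mp hz
      exact Subfield.subset_closure ⟨u, (frobenius_def ..).symm⟩
  have hKp : Module.finrank Kp K = p ^ (r + 3) := by rw [← hcl]; exact hK
  -- RG over `K^p` (IR is trivial for `K^p` itself), hence `K^p`-linear independence of the monomials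
  have hIR : ∀ m : K, m ∈ Kp → O.valuation m = 1 → ∃ u : K, O.valuation (m - u ^ p) < 1 := by
    intro m hm _
    obtain ⟨u, rfl⟩ := RingHom.mem_fieldRange.mp hm
    exact ⟨u, by rw [frobenius_def, sub_self, map_zero]; exact zero_lt_one⟩
  have hRG : ∀ c : (Fin r → Fin p) → K, (∀ i, c i ∈ Kp) →
      O.valuation (∑ i, c i * W i) = Finset.univ.sup (fun i => O.valuation (c i)) :=
    fun c hc => valuation_sum_mul_family_eq_sup O Kp hIR W hPI c hc
  have hBli : LinearIndependent Kp W := by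
    rw [Fintype.linearIndependent_iff]
    intro g hg i
    have hsum : ∑ i, (g i : K) * W i = 0 := by
      have : ∑ i, (g i : K) * W i = ∑ i, g i • W i :=
        Finset.sum_congr rfl fun i _ => (Subfield.smul_def (g i) _).symm
      rw [this, hg]
    have hv := hRG (fun i => (g i : K)) (fun i => (g i).2)
    rw [hsum, map_zero] at hv
    have hle : O.valuation (g i : K) ≤ Finset.univ.sup (fun i => O.valuation (g i : K)) :=
      Finset.le_sup (f := fun i => O.valuation (g i : K)) (Finset.mem_univ i)
    rw [← hv, le_zero_iff, map_eq_zero] at hle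
    exact_mod_cast hle
  have hWmul : ∀ s t, ∃ d : (Fin r → Fin p) → K, W s * W t = ∑ u, d u ^ p * W u := pMonomial_mult p w
  have hW1 : ∃ d : (Fin r → Fin p) → K, ∑ u, d u ^ p * W u = 1 := pMonomial_one p w
  -- degrees: `[K^p(W) : K^p] = p^r`, hence `[K : K^p(W)] = p³`
  have hF₀deg : Module.finrank Kp (IntermediateField.adjoin Kp (Set.range W)) = p ^ r := by
    rw [finrank_adjoin_frame_eq_card W hWmul hW1 hBli, Fintype.card_fun, Fintype.card_fin, Fintype.card_fin]
  have hF₀ : (IntermediateField.adjoin Kp (Set.range W)).toSubfield =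
      Subfield.closure (Set.range W ∪ Set.range (fun x : K => x ^ p)) := by
    rw [IntermediateField.adjoin_toSubfield]
    have hrange : Set.range (algebraMap Kp K) = Set.range (fun x : K => x ^ p) := by
      ext z
      constructor
      · rintro ⟨c, rfl⟩
        obtain ⟨u, hu⟩ := RingHom.mem_fieldRange.mp c.2
        refine ⟨u, ?_⟩
        show u ^ p = (c : K)
        rw [← hu, frobenius_def]
      · rintro ⟨u, rfl⟩
        refine ⟨⟨u ^ p, RingHom.mem_fieldRange.mpr ⟨u, frobenius_def ..⟩⟩, ?_⟩
        rfl
    rw [hrange, Set.union_comm]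
  have hdeg : Module.finrank (Subfield.closure (Set.range W ∪ Set.range (fun x : K => x ^ p))) K = p ^ 3 := by
    have htower := Module.finrank_mul_finrank Kp (IntermediateField.adjoin Kp (Set.range W)) K
    rw [hF₀deg, hKp, pow_add] at htower
    have h3 : Module.finrank (IntermediateField.adjoin Kp (Set.range W)) K = p ^ 3 :=
      Nat.eq_of_mul_eq_mul_left (pow_pos hp.pos r) htower
    have h' : Module.finrank (IntermediateField.adjoin Kp (Set.range W)).toSubfield K = p ^ 3 := h3
    rw [hF₀] at h'
    exact h'
  exact hFrame k K O A hAO hAfg hFrac hdimA hreg hdim3 hzd g₀ hg₀ hdefect htd hnd hP2 Sb b hb (Fin r → Fin p) W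
    (fun e => pMonomial_mem p O w hwO e) hPI hWmul hW1 hdeg

open AlgebraicGeometry CategoryTheory in
/-- **THEOREM T⁗′** (kernel, inputs F-02 = the named fact `CossartPiltant2019` and F-32): the (P2)-slice of the lead's stub for a ground field
of finite `p`-rank and `r` elements of `O_v` with `p`-independent residues, `[K : K^p] = p^{r+3}` — no frame axioms, no separability. [folklore] -/
theorem cleanLU3DefectPRankTwoPMon_of_cossartPiltant2019 (p : ℕ) [Fact p.Prime]
    (hCP : CossartPiltant2019.{0})
    (hEmb : ∀ (Z : Scheme.{0}) [IsIntegral Z] [IsNoetherian Z], Scheme.IsRegular Z →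
      Scheme.IsExcellent Z → ∀ (X : Set Z), IsClosed X → X ≠ Set.univ → topologicalKrullDim X ≤ 2 →
        ∃ (Z' : Scheme.{0}) (π : Z' ⟶ Z), IsProper π ∧ Function.Surjective π.base ∧
          (∃ U : Z.Opens, (U : Set Z) = Xᶜ ∧ IsIso (π ∣_ U)) ∧
          IsStrictNormalCrossingsDivisor Z' (π.base ⁻¹' X))
    : CleanLU3DefectPRankTwoPMonAt p :=
  cleanLU3DefectPRankTwoPMon_of_frame p (cleanLU3DefectPRankTwoFrame_of_cossartPiltant2019 p hCP hEmb)

end PMonomialFrames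

end Summit.ResolutionOfSingularities.ResolutionOfSingularities.Theorems.RadicialJungCleanModels.Lens5TFrame

end
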